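import Summits.BirchSwinnertonDyer.Rank1Residual.GaloisImage.IdentityComponentUnramifiedTwist
import HarnessLib

/-!
# THEOREM A read in `E(K̄_v)`: the local twisted root `Q₀` and the twisting torsion point `T̃`
# (cell `b2b-bsdres`, team n1011, seat p10 GEN 8; THEOREM A programme, FILE 8a)

HONEST FRAMING (cell `b2b-bsdres`, run/shared/lean/b2b/bsd-rank1-residual/, verbatim in every
file): the goal of the cell is to DELETE the COMBINATION-SHAPED residual classes of the
Birch–Swinnerton-Dyer formula for ALL analytic-rank `≤ 1` elliptic curves over `ℚ` — "full BSD
formula for every rank `≤ 1` curve in class `C`" assembled STRICTLY from published theorems — so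
that the rank-`≤ 1` remainder becomes exactly the CONSTRUCTION-SHAPED classes, which are TYPED
(missing-input `Prop`s), NOT attempted. This is not "finishing BSD". Team n1011 (N10 / N11):
research route on the CONSTRUCTION-SHAPED class X4 (§I N11 LOWER half); no claim beyond the stated
classes; nothing is booked; marks UNCHANGED. Theorems only: no definition, no named fact, no
`sorry`. TOOL theorems; they close nothing by themselves.

## What

`exists_localPoints_twist_of_identityComponent`: THEOREM A (FILE 7d, on the points of the model
`V = (M ⊗ K_v) ⊗ K̄_v`) transported to the `Γ_{K_v}`-module `E(K̄_v) = localPoints W K_v` of the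
curve `W/K` itself along a `K_v`-isomorphism `C • W_{K_v} = M ⊗ K_v` (the equivariant transport of
the tree's `Milne2006_unramifiedClass_eq_zero_holds`: `congrEquiv_smul`,
`pointEquivBaseChange_map_algEquiv`, `congrEquiv_baseChange_map`). Output: `Q₀, T̃ ∈ E(K̄_v)` with
`T̃ ≠ 0`, `3 • T̃ = 0`, `T̃` fixed by `Γ_{K_v}`, `Q₀` fixed by `Stab(α)`, `F₀ • Q₀ − Q₀ = T̃`, and
`3 • Q₀` fixed by `Γ_{K_v}` — exactly the binders `(Q₁, hQ₁H, hQ₁, hQ₁m)` of the record shape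
`exists_sha_ne_zero_of_congr_of_unramifiedCubicWitness` (FILE 6) on the `E` side, and the input
of the pigeonhole on the `E'` side (FILE 8b).

References: [MilneADT2006] I.3.8; [SilvermanAEC2009] VII.2.1, VIII.§2.
-/

noncomputable section

open scoped Classical NNReal
open NumberField IsDedekindDomain Field Polynomial

namespace Summit.BirchSwinnertonDyer.Rank1Residual.GaloisImage.TwistedWitness

open WeierstrassCurve Literature.NumberTheory.EllipticCurves Literature.NumberTheory.EllipticCurves.FormalGroupChart
  Literature.NumberTheory.GaloisRepresentations
  Literature.NumberTheory.GaloisRepresentations.IsNonarchimedeanLocalField IsDedekindDomain.HeightOneSpectrum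

variable {K : Type} [Field K] [NumberField K] (W : WeierstrassCurve K) [W.IsElliptic]
  {v : HeightOneSpectrum (𝓞 K)}

set_option maxHeartbeats 800000 in
/-- **THEOREM A in `E(K̄_v)`.** `v ∣ 3`; `C • W_{K_v} = M ⊗ K_v` with `M` integral, cuspidal
reduction `singularModel x₀ y₀ a a`; `α³ = α + 1`, `δ² = −23`, `X³ − X − 1` rootless in `K_v`;
`F₀ • α ≠ α`; `(a₀, b₀)` an integral point of `M` with nonsingular reduction and `3 • (a₀, b₀) = O`.
Then there are `Q₀, T̃ ∈ E(K̄_v)`: `T̃ ≠ 0`, `3 • T̃ = 0`, `T̃` and `3 • Q₀` fixed by `Γ_{K_v}`,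
`Q₀` fixed by `Stab(α)`, `F₀ • Q₀ − Q₀ = T̃`.
[cite: MilneADT2006, Ch. I Prop. 3.8 (proof)] [cite: SilvermanAEC2009, Prop. VII.2.1] -/
theorem exists_localPoints_twist_of_identityComponent
    (h3v : ((3 : ℕ) : 𝓞 K) ∈ v.asIdeal)
    (M : WeierstrassCurve (v.adicCompletionIntegers K)) (C : VariableChange (v.adicCompletion K))
    (hC : C • W.baseChange (v.adicCompletion K) =
      M.map (algebraMap (v.adicCompletionIntegers K) (v.adicCompletion K)))
    (x₀ y₀ a : IsLocalRing.ResidueField (v.adicCompletionIntegers K))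
    (hcusp : M.map (IsLocalRing.residue (v.adicCompletionIntegers K)) = singularModel x₀ y₀ a a)
    {α : AlgebraicClosure (v.adicCompletion K)} (hα : α ^ 3 = α + 1)
    {δ : v.adicCompletion K} (hδ : δ ^ 2 = -23)
    (hnoroot : ∀ x : v.adicCompletion K, x ^ 3 - x - 1 ≠ 0)
    (F₀ : absoluteGaloisGroup (v.adicCompletion K)) (hF₀ : F₀ • α ≠ α)
    {a₀ b₀ : v.adicCompletionIntegers K}
    (hns₀ : (M.map (IsLocalRing.residue (v.adicCompletionIntegers K))).toAffine.Nonsingular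
      (IsLocalRing.residue (v.adicCompletionIntegers K) a₀)
      (IsLocalRing.residue (v.adicCompletionIntegers K) b₀))
    (hm : ((M.map (algebraMap (v.adicCompletionIntegers K) (v.adicCompletion K))).baseChange
        (AlgebraicClosure (v.adicCompletion K))).toAffine.Nonsingular
      (algebraMap (v.adicCompletionIntegers K) (AlgebraicClosure (v.adicCompletion K)) a₀)
      (algebraMap (v.adicCompletionIntegers K) (AlgebraicClosure (v.adicCompletion K)) b₀))
    (h3 : (3 : ℤ) • (Affine.Point.some _ _ hm :
      ((M.map (algebraMap (v.adicCompletionIntegers K) (v.adicCompletion K))).baseChange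
        (AlgebraicClosure (v.adicCompletion K))).toAffine.Point) = 0) :
    ∃ Q₀ T : localPoints W (v.adicCompletion K),
      T ≠ 0 ∧ (3 : ℤ) • T = 0 ∧
      (∀ σ : absoluteGaloisGroup (v.adicCompletion K), σ • T = T) ∧
      (∀ h : absoluteGaloisGroup (v.adicCompletion K), h • α = α → h • Q₀ = Q₀) ∧
      F₀ • Q₀ - Q₀ = T ∧
      (∀ σ : absoluteGaloisGroup (v.adicCompletion K), σ • ((3 : ℤ) • Q₀) = (3 : ℤ) • Q₀) := by
  haveI : Fact (Nat.Prime 3) := ⟨Nat.prime_three⟩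
  haveI : CharZero (v.adicCompletion K) := Literature.NumberTheory.GaloisRepresentations.charZero_adicCompletion v
  obtain ⟨w, hw⟩ := v.exists_spectralValuation
  haveI hMell : (M.map (algebraMap (v.adicCompletionIntegers K) (v.adicCompletion K))).IsElliptic := by
    rw [← hC]; infer_instance
  obtain ⟨P, hPH, hPF⟩ := exists_map_sub_eq_twist_of_identityComponent hw M h3v x₀ y₀ a hcusp hα hδ
    hnoroot F₀ hF₀ hns₀ hm h3
  -- the equivariant transport `E(K̄_v) ≃ V(K̄_v)`
  have hC' := congrArg (fun X : WeierstrassCurve (v.adicCompletion K) ↦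
    X.baseChange (AlgebraicClosure (v.adicCompletion K))) hC
  let Φ : localPoints W (v.adicCompletion K) ≃+
      ((M.map (algebraMap (v.adicCompletionIntegers K) (v.adicCompletion K))).baseChange
        (AlgebraicClosure (v.adicCompletion K))).toAffine.Point :=
    ((WeierstrassCurve.Affine.Point.congrEquiv (WeierstrassCurve.baseChange_baseChange_adicCompletion W v).symm).trans
      (WeierstrassCurve.VariableChange.pointEquivBaseChange (W.baseChange (v.adicCompletion K)) C
        (AlgebraicClosure (v.adicCompletion K)))).trans
      (WeierstrassCurve.Affine.Point.congrEquiv hC')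
  have hΦ : ∀ (σ : absoluteGaloisGroup (v.adicCompletion K)) (Q : localPoints W (v.adicCompletion K)),
      Φ (σ • Q) = WeierstrassCurve.Affine.Point.map ((absoluteGaloisGroup.toAlgEquiv (v.adicCompletion K) σ :
          AlgebraicClosure (v.adicCompletion K) ≃ₐ[v.adicCompletion K] AlgebraicClosure (v.adicCompletion K)) :
          AlgebraicClosure (v.adicCompletion K) →ₐ[v.adicCompletion K] AlgebraicClosure (v.adicCompletion K))
        (Φ Q) := by
    intro σ Q
    change WeierstrassCurve.Affine.Point.congrEquiv hC' (WeierstrassCurve.VariableChange.pointEquivBaseChange (W.baseChange (v.adicCompletion K)) C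
        (AlgebraicClosure (v.adicCompletion K))
        (WeierstrassCurve.Affine.Point.congrEquiv (WeierstrassCurve.baseChange_baseChange_adicCompletion W v).symm (σ • Q))) =
      WeierstrassCurve.Affine.Point.map _ (WeierstrassCurve.Affine.Point.congrEquiv hC'
        (WeierstrassCurve.VariableChange.pointEquivBaseChange (W.baseChange (v.adicCompletion K)) C
          (AlgebraicClosure (v.adicCompletion K))
          (WeierstrassCurve.Affine.Point.congrEquiv (WeierstrassCurve.baseChange_baseChange_adicCompletion W v).symm Q)))
    rw [WeierstrassCurve.congrEquiv_smul, WeierstrassCurve.VariableChange.pointEquivBaseChange_map_algEquiv]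
    exact WeierstrassCurve.Affine.Point.congrEquiv_baseChange_map hC _ _
  -- the torsion point `T_V = (a₀, b₀)` is fixed by `Γ_{K_v}`
  have hTfix : ∀ σ : absoluteGaloisGroup (v.adicCompletion K),
      WeierstrassCurve.Affine.Point.map ((absoluteGaloisGroup.toAlgEquiv (v.adicCompletion K) σ :
          AlgebraicClosure (v.adicCompletion K) ≃ₐ[v.adicCompletion K] AlgebraicClosure (v.adicCompletion K)) :
          AlgebraicClosure (v.adicCompletion K) →ₐ[v.adicCompletion K] AlgebraicClosure (v.adicCompletion K))
        (Affine.Point.some _ _ hm) = Affine.Point.some _ _ hm := by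
    intro σ
    rw [Affine.Point.map_some]
    refine point_some_eq_some ?_ ?_
    · change absoluteGaloisGroup.toAlgEquiv (v.adicCompletion K) σ
        (algebraMap (v.adicCompletionIntegers K) (AlgebraicClosure (v.adicCompletion K)) a₀) = _
      rw [IsScalarTower.algebraMap_apply (v.adicCompletionIntegers K) (v.adicCompletion K)
        (AlgebraicClosure (v.adicCompletion K))]
      exact AlgEquiv.commutes _ _
    · change absoluteGaloisGroup.toAlgEquiv (v.adicCompletion K) σ
        (algebraMap (v.adicCompletionIntegers K) (AlgebraicClosure (v.adicCompletion K)) b₀) = _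
      rw [IsScalarTower.algebraMap_apply (v.adicCompletionIntegers K) (v.adicCompletion K)
        (AlgebraicClosure (v.adicCompletion K))]
      exact AlgEquiv.commutes _ _
  set Q₀ : localPoints W (v.adicCompletion K) := Φ.symm P with hQ₀
  set T : localPoints W (v.adicCompletion K) := Φ.symm (Affine.Point.some _ _ hm) with hT
  have hT0 : T ≠ 0 := by
    rw [hT]
    exact (AddEquiv.map_ne_zero_iff Φ.symm).mpr (Affine.Point.some_ne_zero _)
  have hT3 : (3 : ℤ) • T = 0 := by rw [hT, ← map_zsmul, h3, map_zero]
  have hTσ : ∀ σ : absoluteGaloisGroup (v.adicCompletion K), σ • T = T := fun σ ↦ by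
    apply Φ.injective
    rw [hΦ, hT, AddEquiv.apply_symm_apply, hTfix]
  have hQ₀H : ∀ h : absoluteGaloisGroup (v.adicCompletion K), h • α = α → h • Q₀ = Q₀ := fun h hh ↦ by
    apply Φ.injective
    rw [hΦ, hQ₀, AddEquiv.apply_symm_apply, hPH h hh]
  have hQ₀F : F₀ • Q₀ - Q₀ = T := by
    apply Φ.injective
    rw [map_sub, hΦ, hQ₀, hT, AddEquiv.apply_symm_apply, AddEquiv.apply_symm_apply, hPF]
  refine ⟨Q₀, T, hT0, hT3, hTσ, hQ₀H, hQ₀F, fun σ ↦ ?_⟩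
  -- `σ = F₀^i h` and `F₀ • (3 • Q₀) = 3 • Q₀ + 3 • T = 3 • Q₀`
  set H : Subgroup (absoluteGaloisGroup (v.adicCompletion K)) :=
    MulAction.stabilizer (absoluteGaloisGroup (v.adicCompletion K)) α with hHdef
  haveI hHn : H.Normal := normal_stabilizer_cubicRoot hα hδ
  have hHi : H.index = 3 := index_stabilizer_cubicRoot hα hδ hnoroot
  have hF₀H : F₀ ∉ H := fun h ↦ hF₀ (MulAction.mem_stabilizer_iff.mp h)
  obtain ⟨i, h, hh, rfl⟩ := exists_pow_mul_of_index_eq_prime H hHi hF₀H σ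
  have hh3 : h • ((3 : ℤ) • Q₀) = (3 : ℤ) • Q₀ := by
    rw [W.smul_zsmul_localPoints, hQ₀H h (MulAction.mem_stabilizer_iff.mp hh)]
  have hF3 : F₀ • ((3 : ℤ) • Q₀) = (3 : ℤ) • Q₀ := by
    have e : F₀ • Q₀ = Q₀ + T := by rw [← hQ₀F]; abel
    rw [W.smul_zsmul_localPoints, e, zsmul_add, hT3, add_zero]
  rw [mul_smul, hh3]
  clear hh
  induction i with
  | zero => rw [pow_zero, one_smul]
  | succ n ih => rw [pow_succ, mul_smul, hF3, ih]

end Summit.BirchSwinnertonDyer.Rank1Residual.GaloisImage.TwistedWitness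

end
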